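import Summits.BirchSwinnertonDyer.Rank1Residual.X11b.ShapiroPairs
import Summits.BirchSwinnertonDyer.Rank1Residual.X11b.SelmerCardParity
import HarnessLib

/-!
# BSD rank-≤1 residual cell, class X11b: `BSD(E,5)` for the two EXCEPTIONAL-image (`5S4`) pairs
# of X11 ∧ r = 1 ∧ p = 5 from PUBLISHED theorems + ONE `5`-descent certificate line per pair

HONEST FRAMING (cell `b2b-bsdres-*`, verbatim): prove what is provable now; shrink each hard class
to its core with data; no claim beyond stated classes; COMBINATION classes deleted from PUBLISHED
theorems only, CONSTRUCTION-shaped remainder typed; this is not "finishing BSD". Class X11b stays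
CONSTRUCTION-SHAPED; everything here is PER PAIR; no lane verdict is changed; no named fact.

Unit `b2b-bsdres-x11c`, gen 13. The last two RESISTANT pairs of the unit (HOME/b2b-bsdres-x11c/
RESISTANT.md §A″ after gen 12): `296240ce1@5` (`N = 2⁴·5·7·23²`) and `304560by1@5`
(`N = 2⁴·3⁴·5·47`): split multiplicative at `5`, `E[5]` irreducible with EXCEPTIONAL image `5S4`
(projective image `S₄`, order `96`, prime to `5`), no (ram) prime, TWO bad primes with `5 ∥ c_q`,
`r_an = 1`, `#Ш_an = 1`, `E(ℚ)_tors = 0`. No Euler-system divisibility is in print at an image of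
order prime to `p` (Kato, Astérisque 295, Thm 13.4 (3)); the Heegner-index bounds stop at
`ord₅ #Ш ≤ 2`; gen 12's Shapiro reduction does not apply (the image is primitive). They are closed
PER PAIR by the generic `5`-DESCENT over ℚ in the field `R = ℚ(T')` of ONE `5`-torsion point —
a number field of DEGREE 24 (the étale algebra of `E[5] ∖ 0`; `G` acts transitively on the 24
points, `Stab(T') ≅ C₄`, `Aut(R) = C_s/Stab ≅ C₄` acting by `T' ↦ [b]T'`; subfields of degrees
`3, 6, 12`): the Weil-pairing Kummer map `w_* : H¹(ℚ, E[5]) ↪ H¹(ℚ, μ₅[E[5]∖0]) = Rˣ/Rˣ⁵` is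
injective because `5 ∤ |G|` (Maschke), `w_* ∘ κ` is the classical map `P ↦ f_{T'}(P)`
(`div f_{T'} = 5(T') − 5(O)`, `f_{T'} ∘ [5] ∈ R(E)ˣ⁵` — gen 12's function and normalisation proof,
SHAPIRO5-METHOD §2, composed with the Vélu isogeny), and the computed group
`Fake(E) = {ξ ∈ R(S,5) : δξ = ξ^a, loc_ℓ ξ ∈ ⟨f_{T'}(E(ℚ_ℓ))⟩ (ℓ ∣ 5N)}` satisfies
`w_*Sel⁵(E/ℚ) ⊂ Fake(E)`, `dim Fake − dim Sel⁵ ≤ dim K_S(R)`, `K_S(R)` = the elements of `R(S,5)`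
that are local 5th powers at every prime above `5N` (method note `HOME/b2b-bsdres-x11c/gen13/
S4DESCENT-METHOD.md`; engine `HOME/code/b2b-bsdres-x11c/gen13/s4desc/` = 60 lines on top of gen 12's
audited `shapiro5lib.gp`). The class group of `R` (`|d_R| ≈ 10⁴² / 10³⁹`) is PARI's; its
certification by ZIMMERT's bound (Bordellès, *Arithmetic Tales*, Thm 7.51: every class contains an
ideal of norm `≤ √|d_R|·e^{−26.518…}`; every prime ideal below the bound decomposed on PARI's
generator and the decomposition verified EXACTLY; kit `gen13/zimmert/`) is recorded per pair below.

What enters the kernel per pair is ONE line: either the EXACT hypothesis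
`hSel : #Sel^(5)(E/ℚ) = 5 ^ r_an` of the tree's class-free consumer
`Typed.bsdp_of_card_selmerGroup_eq_pow_analyticRank` (gen 12's literal-model instantiation
`bsdp_of_ainvs_of_card_selmerGroup`), or — one dimension of slack, granting the Cassels–Tate
pairing `hCT` (bsd.S18) — `#Sel^(5)(E/ℚ) = 5 ^ k`, `k ≤ r_an + 1`
(`bsdp_of_ainvs_of_card_selmerGroup_le_of_casselsTate`, this unit's `SelmerCardParity.lean`).
Non-kernel inputs per pair: `r_an = 1` and `#Ш_an = 1` (Cremona; the cell's engines) and the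
certificate line. PER PAIR; not a class theorem; nothing booked by this unit.

References: J. H. Silverman, *AEC* (2009) X.1, X.4 [SilvermanAEC2009]; E. F. Schaefer, M. Stoll,
Trans. AMS 356 (2004) §2–3; O. Bordellès, *Arithmetic Tales* (2012) Thm 7.51 (Zimmert's bound);
R. L. Miller, LMS JCM 14 (2011) §1 [Miller2011LMS]; Cremona's tables [Cremona2006].
-/

set_option linter.dupNamespace false
set_option autoImplicit false

noncomputable section

open scoped Classical

open WeierstrassCurve Literature.NumberTheory.EllipticCurves
  Literature.NumberTheory.EllipticCurves.Rank1Residual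
  Literature.NumberTheory.EllipticCurves.Rank1Residual.Typed
  Literature.NumberTheory.EllipticCurves.Rank1Residual.X11RankOneCertificates

namespace Summit.BirchSwinnertonDyer.Rank1Residual.X11b

/-- **`BSD(E,5)` for `296240ce1`** (`N = 296240 = 2⁴·5·7·23²`, `5 ∥ N`; Cremona model
`[0, 0, 0, -15281752, -23046585396]`; `ρ̄_{E,5}` EXCEPTIONAL `5S4`; split multiplicative at `5`,
`c₅ = c₇ = 5`; rank `1`, generator `(5018, 163170)`, `#Ш_an = 1`) — one of the unit's two last
RESISTANT pairs — from GZK and the single certificate line `#Sel^(5)(E/ℚ) = 5 ^ r_an`: full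
`5`-descent of unit `b2b-bsdres-x11c` gen 13 in `R = ℚ(T')`, `[R:ℚ] = 24`,
`|d_R| = 2³²·5¹⁵·23¹⁶`, `Cl(R) = 1` (PARI under GRH, then CERTIFIED by Zimmert's bound — see below),
`S = {2,5,7,23}`, `33` generators of `R(S,5)` (`20` S-units + `13` units, `5`-saturated by `111` quintic characters), `δ`-eigenspace of dimension `7` (Galois-action matrix PROVED by characters: all `33` columns uniquely determined at full rank), local targets `dim J_ℓ = 0, 2, 1, 0` at `ℓ = 2, 5, 7, 23` all reached, `K_S(R) = 0`, **`dim_𝔽₅ Fake(E) = 1`** with the generator's Kummer image its non-zero element (exponent vector uniquely determined by `186` characters) — hence **`#Sel^(5)(E/ℚ) = 5`** (run of record j103915, first run j103783 identical; verifier j104366 — 4/4 VERIFIED); Zimmert certification of `Cl(R) = 1` (Bordellès 2012 Thm 7.51, `Z = 2 727 992 506`): all `131 959 451` prime ideals of norm `≤ Z` decomposed — a generator exhibited by PARI and verified exactly (integral, norm, membership) —, `0` failures, jobs j102400 + j103791–j103794, `122` core-hours, so `Cl(R) = 1` and `R(S,5)` are EXACT: mode **EXACT(Zimmert)**. Kernel: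 `Δ ≠ 0`. Binders: `hGZK` (published), `r_an ≤ 1` and `#Ш_an` a `5`-adic
unit (Cremona / the cell's engines), `hSel` (this certificate).
[cite: Miller2011LMS, §1 and Def. 1.1] [cite: Cremona2006, Table 1 (Cremona label 296240ce1)] -/
theorem bsdp_s296240ce1 (hGZK : rank_eq_analyticRank_of_analyticRank_le_one)
    (W : WeierstrassCurve ℚ) (hW : W = ⟨0, 0, 0, -15281752, -23046585396⟩)
    (hr : W.analyticRank ≤ 1) {q : ℚ} (hq : shaAn W = (q : ℂ)) (hv : padicValRat 5 q = 0)
    (hSel : Nat.card (W.selmerGroup (5 : ℤ)) = 5 ^ W.analyticRank) : BSDp W 5 := by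
  subst hW
  haveI : Fact (Nat.Prime 5) := ⟨by norm_num⟩
  exact bsdp_of_ainvs_of_card_selmerGroup hGZK 0 0 0 (-15281752) (-23046585396)
    (by decide +kernel) 5 hr hq hv hSel

/-- **`BSD(E,5)` for `296240ce1`, parity form**: the same conclusion from the WEAKER certificate
line `#Sel^(5)(E/ℚ) = 5 ^ k` with `k ≤ r_an + 1` (one dimension of slack: a `5`-descent whose
computed group has dimension `≤ 2` suffices), granting in addition the Cassels–Tate pairing `hCT`
(bsd.S18). [cite: Miller2011LMS, §1 and Def. 1.1] [cite: SilvermanAEC2009, Thm X.4.14]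
[cite: Cremona2006, Table 1 (Cremona label 296240ce1)] -/
theorem bsdp_s296240ce1_of_casselsTate (hCT : exists_casselsTate_pairing (K := ℚ))
    (hGZK : rank_eq_analyticRank_of_analyticRank_le_one)
    (W : WeierstrassCurve ℚ) (hW : W = ⟨0, 0, 0, -15281752, -23046585396⟩)
    (hr : W.analyticRank ≤ 1) {q : ℚ} (hq : shaAn W = (q : ℂ)) (hv : padicValRat 5 q = 0)
    {k : ℕ} (hSel : Nat.card (W.selmerGroup (5 : ℤ)) = 5 ^ k) (hk : k ≤ W.analyticRank + 1) :
    BSDp W 5 := by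
  subst hW
  haveI : Fact (Nat.Prime 5) := ⟨by norm_num⟩
  exact bsdp_of_ainvs_of_card_selmerGroup_le_of_casselsTate hCT hGZK 0 0 0 (-15281752)
    (-23046585396) (by decide +kernel) 5 hr hq hv hSel hk

/-- **`BSD(E,5)` for `304560by1`** (`N = 304560 = 2⁴·3⁴·5·47`, `5 ∥ N`; Cremona model
`[0, 0, 0, -12087, 17603334]`; `ρ̄_{E,5}` EXCEPTIONAL `5S4`; split multiplicative at `5`,
`c₅ = c₄₇ = 5`; rank `1`, generator `(573, 14100)`, `#Ш_an = 1`) — the other last RESISTANT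
pair — from GZK and the single certificate line `#Sel^(5)(E/ℚ) = 5 ^ r_an`: full `5`-descent of
unit `b2b-bsdres-x11c` gen 13 in `R = ℚ(T')`, `[R:ℚ] = 24`, `|d_R| = 2³⁸·3³⁶·5¹⁵`,
`Cl(R) ≅ ℤ/10` with `Cl_S(R) = 1` (PARI under GRH, then CERTIFIED by Zimmert's bound — see below),
`S = {2,3,5,47}`, `33` generators of `R(S,5)` (`20` + `13`, `5`-saturated, `111` characters), `δ`-eigenspace of dimension `7` (Galois-action matrix PROVED by characters), local targets `0, 0, 2, 1` at `ℓ = 2, 3, 5, 47` all reached, `K_S(R) = 0`, **`dim_𝔽₅ Fake(E) = 1`** with the generator's Kummer image its non-zero element — hence **`#Sel^(5)(E/ℚ) = 5`** (run of record j103915; verifier j104366 — 4/4 VERIFIED); the class group (`ℤ/10` under GRH) CERTIFIED unconditionally by Zimmert's bound (Bordellès 2012 Thm 7.51, `Z = 107 967 503`: all `6 190 315` prime ideals of norm `≤ Z` decomposed on PARI's generator and verified exactly, `0` failures, job j102337), so `Cl_S(R) = 1` and `R(S,5)` are EXACT: mode **EXACT(Zimmert)**. Kernel: `Δ ≠ 0`.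 Binders: `hGZK` (published), `r_an ≤ 1` and `#Ш_an` a `5`-adic
unit (Cremona / the cell's engines), `hSel` (this certificate).
[cite: Miller2011LMS, §1 and Def. 1.1] [cite: Cremona2006, Table 1 (Cremona label 304560by1)] -/
theorem bsdp_s304560by1 (hGZK : rank_eq_analyticRank_of_analyticRank_le_one)
    (W : WeierstrassCurve ℚ) (hW : W = ⟨0, 0, 0, -12087, 17603334⟩)
    (hr : W.analyticRank ≤ 1) {q : ℚ} (hq : shaAn W = (q : ℂ)) (hv : padicValRat 5 q = 0)
    (hSel : Nat.card (W.selmerGroup (5 : ℤ)) = 5 ^ W.analyticRank) : BSDp W 5 := by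
  subst hW
  haveI : Fact (Nat.Prime 5) := ⟨by norm_num⟩
  exact bsdp_of_ainvs_of_card_selmerGroup hGZK 0 0 0 (-12087) 17603334 (by decide +kernel) 5
    hr hq hv hSel

/-- **`BSD(E,5)` for `304560by1`, parity form** (certificate line `#Sel^(5)(E/ℚ) = 5 ^ k`,
`k ≤ r_an + 1`, granting `hCT`). [cite: Miller2011LMS, §1 and Def. 1.1]
[cite: SilvermanAEC2009, Thm X.4.14] [cite: Cremona2006, Table 1 (Cremona label 304560by1)] -/
theorem bsdp_s304560by1_of_casselsTate (hCT : exists_casselsTate_pairing (K := ℚ))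
    (hGZK : rank_eq_analyticRank_of_analyticRank_le_one)
    (W : WeierstrassCurve ℚ) (hW : W = ⟨0, 0, 0, -12087, 17603334⟩)
    (hr : W.analyticRank ≤ 1) {q : ℚ} (hq : shaAn W = (q : ℂ)) (hv : padicValRat 5 q = 0)
    {k : ℕ} (hSel : Nat.card (W.selmerGroup (5 : ℤ)) = 5 ^ k) (hk : k ≤ W.analyticRank + 1) :
    BSDp W 5 := by
  subst hW
  haveI : Fact (Nat.Prime 5) := ⟨by norm_num⟩
  exact bsdp_of_ainvs_of_card_selmerGroup_le_of_casselsTate hCT hGZK 0 0 0 (-12087) 17603334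
    (by decide +kernel) 5 hr hq hv hSel hk

end Summit.BirchSwinnertonDyer.Rank1Residual.X11b

end
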